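import Mathlib
import HarnessLib
import HarnessLib.Audit
import Summits.ABC.Statement
import Literature.NumberTheory.Automorphic.BCDTModularity
import Literature.NumberTheory.GaloisRepresentations.ModPGaloisRep
import Summits.ABC.ABC.Theorems.PlacewiseSzpiroSingleTowerSzpiroMersenneRadicalRungs
import HarnessLib.Audit.Status.Attr

/-!
Route: LevelLoweredSzpiro

# Route LevelLoweredSzpiro — Level-lowered Szpiro at one prime l >= 7 via the Serre level gives
polynomial Szpiro

D-0145 ideator LINE (abc-idea-5 g0, lens «transfer»: function-field Szpiro → E/ℚ with an explicit
dictionary; the first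
non-transferring step is the crux). NO SUMMIT, RUNG OR CONJUNCT IS PROVED BY A LINE BEING
REGISTERED; NOT abc — POLY-SZPIRO(E);
typed ≠ proved; computed ≠ proved; abc distance = number of OPEN summit-strength items. It suffices
(for the registered rung
A-PS = `Summit.ABC.PolySzpiroRat`) to show X = X1 ∧ X2: X1 = LEVEL-LOWERED SZPIRO at ONE prime ℓ ≥
7: log|Δ_min(E)| ≤
K·log(ℓ·N(ρ̄_{E,ℓ})) + C for all E/ℚ, where N(ρ̄_{E,ℓ}) is the SERRE LEVEL (prime-to-ℓ Artin
conductor) of the mod-ℓ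
representation (tree: `ModPGaloisRep.serreLevel`, `WeierstrassCurve.IsTorsionGaloisRep`) — by Tate's
criterion it is N(E)
with every multiplicative prime p whose tower height n_p = ord_p Δ_min is divisible by ℓ REMOVED; X2
= the DICTIONARY PAYOFF
X1 ⟹ A-PS (N(ρ̄_{E,ℓ}) ∣ N(E), Carayol–Serre, plus existence of the framed mod-ℓ representation).
bears_on: LADDER-ABC:A-PS.
Lean: `SerreLevelSzpiro ∧ SerreLevelPayoff`

## Assembly
Modus ponens: X2 is the implication X1 → A-PS, so `closes (h₁ : SerreLevelSzpiro) (h₂ :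
SerreLevelPayoff) : Summit.ABC.PolySzpiroRat := h₂ h₁` (glue.lean; closes_target A-PS =
`Summit.ABC.PolySzpiroRat`, a registered alternative closer of ABC/ABC; NOT abc). The real content
of X2 (existence of ρ̄_{E,ℓ}, N(ρ̄) ∣ N(E), log-monotonicity, the sign of K) is proved by whoever
closes X2; X1 is the open rung.

CLOSES_TARGET: closes rung ABC-A-PS of ABC: Summit.ABC.PolySzpiroRat (D-0061; not the summit Statement) — the deciding theorem of this route concludes that registered leaf instead of the Statement decl `ABC` (class rung: servable and labelled, never counted as concluding the summit Statement).

Rationale: WHY THIS LINE. The level-ℓ MODULI proof of function-field Szpiro (Szpiro, Astérisque 183 (1990) §1;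
Hindry–Silverman 1988; cf. SilvermanATAEC1994
§III ex. 3.37–3.39): for E/k(C) non-isotrivial and a prime ℓ ≥ 7 (genus X(ℓ) ≥ 3), let C_ℓ =
normalisation of C in k(C)(E[ℓ]);
Riemann–Hurwitz for C_ℓ → X(ℓ) (row A) and for C_ℓ → C (row B) give deg Δ_min ≤
(6ℓ/(ℓ−6))·(2g−2+s_ℓ) with s_ℓ = #{bad v : ℓ ∤ n_v}
— places with ℓ ∣ n_v are UNRAMIFIED in C_ℓ/C (Tate curve) and drop out; equality 24·7 = 42·4 on the
universal curve over X(7).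
Dictionary: deg Δ_min ↦ log|Δ_min|; 2g−2+s_ℓ ↦ log(ℓ·N(ρ̄_{E,ℓ})) (Serre 1987 §1.2, §4.1; the level
of Ribet's theorem); row B ↦
Hensel/Serre–Tate bound log|disc ℚ(E[ℓ])| ≤ c(ℓ)·log(ℓ·N(ρ̄)) (TRANSFERS, theorem:
SilvermanATAEC1994 §IV.10, Serre1987 §1);
row A ↦ a uniform height bound for the moduli point of E on X(ℓ) over ℚ(E[ℓ]) by disc ℚ(E[ℓ]) (DOES
NOT TRANSFER: effective
Mordell on X(ℓ) over division fields) — so the first non-transferring step, typed in the weakest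
currency the assembly needs,
is X1. Imported: Galois representations / Serre's conductor (arithmetic of modular forms) into the
Szpiro ladder. What it does
that listed routes do not: PlacewiseSzpiro bounds ONE tower by log N; TamagawaTwistDictionary uses
Tamagawa products; the abc-ff
transfer sheets type the Kodaira–Spencer OUTPUT inequality (RKS ≡ abc, RKSPolar); RC-H08/C7
(Moret-Bailly) is uniform effective
Mordell itself. Nobody has typed the level-lowered rung: the conductor on the right OMITS every
prime whose tower is ℓ-divisible,
exactly as on the function-field side, and the statement is provably ℓ-sensitive (FALSE for ℓ ≤ 5,
where X(ℓ) has genus 0: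
full 2-torsion families have trivial ρ̄_{E,2} and unbounded Δ_min) — the arithmetic shadow of
genus(X(ℓ)) ≥ 2 ⟺ ℓ ≥ 7.
Sandwich (paper, elementary): Szpiro(6+ε) with 6+ε < ℓ ⟹ X1(ℓ) [Σ_{ℓ∣n_p} n_p log p ≥
ℓ·log(N/N(ρ̄))] and X1 ⟹ A-PS [N(ρ̄) ∣ N];
so abc ⟹ Szpiro ⟹ X1 ⟹ A-PS: a RUNG INSERTION strictly inside the ladder, honest under the A-PS
NEW-INPUT RULE (REDUCTION-CENSUS
v2.12 l.13): the new input NAMED is the Serre level as the Szpiro currency; no new analytic engine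
is claimed.

RANKED CRUXES. #2 SerreLevelSzpiro (crux) — LEVEL-LOWERED SZPIRO: there is a prime ℓ ≥ 7 and
constants K, C such that for every elliptic curve E/ℚ (any model W) and every framed mod-ℓ
representation ρ realising E[ℓ], log|Δ_min(E)| ≤ K·log(ℓ·N(ρ)) + C, N(ρ) = Serre level (prime-to-ℓ
Artin conductor) of ρ. [difficulty: open-problem] (why it might fail: It bounds ℓ-divisible towers
n_p = ℓm at primes p ABSENT from N(ρ̄) by the other primes only; true under Szpiro(6+ε<ℓ) but no
engine: effective Mordell for X(ℓ)-points over ℚ(E[ℓ]) is open (Faltings ineffective; Chabauty needs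
r<g); K<6 is refuted (Masser).) [Serre1987, SilvermanATAEC1994, arXiv:math/0508174, Faltings1983,
BombieriGubler2006]
#3 SerreLevelPayoff (crux) — DICTIONARY PAYOFF: level-lowered Szpiro at one prime ℓ ≥ 7 implies
polynomial Szpiro over ℚ (A-PS): for every E/ℚ a framed mod-ℓ representation ρ with E[ℓ] ≅ ρ exists
(tree `exists_isTorsionGaloisRep`) and its Serre level divides N(E) (Carayol–Serre (1.2)–(4.1); tree
`serreLevel_baseChange_dvd_conductorNorm_of_artinConductorExponent` modulo the exponentwise
Ogg–Saito identification), so log(ℓ·N(ρ)) ≤ log ℓ + log N(E). [deps: SerreLevelSzpiro] [difficulty: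
M] (why it might fail: N(ρ̄)∣N(E) for ALL E incl. additive reduction at 2, 3 needs the exponentwise
Ogg–Saito fact `artinConductorExponent_tate_eq_conductorExponent_of_isElliptic` (named, undischarged
in tree, size L; semistable case proved); serreLevel junk value (=1) is harmless here.) [Serre1987,
SilvermanATAEC1994, DarmonDiamondTaylor1995]

TWO-LAYER PLAN. Foreseen glued split of SerreLevelSzpiro along the two Riemann–Hurwitz rows of the
function-field proof (BC3 birth skeleton, checked rc 0, composition sorry-free): SerreLevelSzpiro ⇐
DivisionFieldSzpiro → DivisionFieldDiscBound → SerreLevelSzpiro, where DivisionFieldDiscBound (row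
B: log|disc ℚ(E[ℓ])| ≤ c(ℓ)·log(ℓ·N(ρ̄)) + c(ℓ); Hensel + Néron–Ogg–Shafarevich + Tate curve;
provable, size M–L over `WeierstrassCurve.divisionField`) and DivisionFieldSzpiro (row A: log|Δ_min|
≤ A·log|disc ℚ(E[ℓ])| + B at one ℓ ≥ 7; the non-transferring effective-Mordell row). BC5 rungs
(plan-only stubs in the same skeleton): bounded Serre level at ℓ ≥ 7 ⇒ bounded Δ_min
(Hermite–Minkowski + Faltings on the genus-≥3 twists X_ρ̄(ℓ)); the ℓ = 2 instance is FALSE (negative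
calibration).

KILL CRITERIA. A proof of ¬SerreLevelSzpiro (for EVERY prime ℓ ≥ 7 a family E_n with
log|Δ_min(E_n)|/log(ℓ·N(ρ̄_{E_n,ℓ})) → ∞) closes the route refuted:SerreLevelSzpiro — and, via the
elementary sandwich, refutes Szpiro's conjecture with exponent < ℓ for every ℓ, i.e. Szpiro itself;
so a refutation is abc-news. A proof that SerreLevelPayoff needs more than Ogg–Saito (e.g. N(ρ̄) ∤
N(E) for some additive E) forces a restatement of X1 with N(E)·ℓ in place of the Serre level at
additive primes (pivot, not death). A-PS proved elsewhere moots the route.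

NOT DECOMPOSED YET. The effective-Mordell row (DivisionFieldSzpiro) is not split further at open:
its natural children (a height bound on GL₂(𝔽_ℓ)-twists of X(ℓ) uniform in the twist; comparison
h(j(E)) ↔ log|Δ_min| — Silverman's height comparison, provable) are layer-2, filed only if the route
is staffed. The choice of ℓ (7 vs 11: X_ρ̄(11) has genus 26 and fewer low-degree points) is left
open by the ∃. Constants are not optimised (FF value K = 6ℓ/(ℓ−6) = 42 at ℓ = 7 is recorded under
Numbers, not claimed).

CHEAPEST FALSIFIER. INSTRUMENT σ_ℓ (described, kit 0 on this seat; a refuter with kit tag abc runs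
it in one job): over Cremona ecdata N < 500000 compute N_ℓ(E) := N(E)/∏{p ∥ N(E), p ≠ ℓ, ℓ ∣ ord_p
Δ_min} p and σ_ℓ(E) := log|Δ_min|/log(ℓ·N_ℓ(E)) for ℓ ∈ {2,3,5,7,11,13}; report the band maxima of
σ_ℓ per conductor decade. Prediction (FF dictionary): σ_7, σ_11, σ_13 have FLAT envelopes (FF values
42, 16.5, 11.1 are ceilings for the generic family, the ℚ-envelope should sit far lower, near the
Szpiro envelope 8.9), while σ_2, σ_3, σ_5 GROW along full-2-torsion / 3-torsion / 5-torsion families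
(genus-0 levels). A growing σ_7 band maximum along any family refutes X1 at ℓ = 7
numerically-suggestively and (if it persists for 11, 13) the line; it would also be numerical
evidence against Szpiro(6+ε) itself. In-Lean cheapest check run: BC2/BC7 probes (X1 ↛ A-PS, X1 ↛ ABC
cheaply; A-PS ↛ X1; verdicts CLEAN).

NUMBERS. FF constants: deg Δ_min ≤ (6ℓ/(ℓ−6))(2g−2+s_ℓ): 42 (ℓ=7), 16.5 (ℓ=11), 78/7 (ℓ=13); → 6 as
ℓ → ∞ (Szpiro's 6). Over ℚ: K ≤ 6 refuted for every C even with the full conductor (Masser 1990;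
tree `Summit.ABC.Analytic.not_polySzpiroRatEff_of_le_six`), so 6 < K; Cremona floor σ =
log|Δ_min|/log N ≤ 8.9037 (N < 5·10⁵, tree docstring of `PolySzpiroRatEff`); σ_ℓ ≥ σ always (N_ℓ ≤
N). |GL₂(𝔽_ℓ)| = (ℓ²−1)(ℓ²−ℓ) = 2016 at ℓ = 7 bounds [ℚ(E[ℓ]):ℚ]; genus X(ℓ) = 1 + (ℓ²−1)(ℓ−6)/24 =
3, 26, 50 at ℓ = 7, 11, 13; Mazur–Kenku–K-W: semistable E with N(ρ̄_{E,ℓ}) = 1 forces ℓ ≤ 7 resp.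
reducible E[ℓ] (RC-PF4, GCD-type, used only as a sanity rung).

DEFINITION REQUESTS. None filed: `WeierstrassCurve.divisionField`, `ModPGaloisRep.serreLevel`,
`WeierstrassCurve.IsTorsionGaloisRep`, `NumberField.discr` exist. Wanted later (not blocking): a
named Literature fact for the Hensel/Serre–Tate discriminant bound of ℚ(E[ℓ]) (row B), topic
Literature/NumberTheory/EllipticCurves.

Novelty: Searches (2026-08-28): lit search --hybrid "Szpiro function field modular curve level structure
Riemann-Hurwitz discriminant conductor" (8 docs: [corpus:silverman1994 pp 270–272, 519],
[corpus:david1995 pp 63–69], [corpus:cornell1997 pp 583–588]); lit search --hybrid "effective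
Mordell height bound rational points modular curve discriminant number field uniform" (8:
[corpus:bombieri2006 pp 346–350], [corpus:baker2007 p 147]); lit vsearch "minimal discriminant
bounded by a power of the Artin conductor of its mod p representation" (8, none on point:
silverman1994/2009, david1995, cornell1997 p 63–64); lit galaxy search "twists of X(7)|Serre
conductor|level lowering" --star all (22 rows, 0 relevant); lit galaxy search "effective
Mordell|effective Faltings|effective Shafarevich" --star all ([galaxy:panama:195429601902662]
Baker–Wüstholz, [galaxy:pdf:2127013957766367820] van Frankenhuysen abc ⇒ effective Mordell,
[galaxy:pdf:5879193849392281060] von Känel publication list — effective Shafarevich via modularity);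
lean search serreLevel / IsTorsionGaloisRep / divisionField (tree API found, no statement of shape
X1); ledger negatives --problem ABC (2 entries: BelyiSqueeze stmt-ABC-1205, GlobalQuasiLogDerivative
stmt-ABC-1689 — neither is X1/X2); REDUCTION-CENSUS v2.12 §LINES/§S/RC-H08/RC-PF4/C7 read.
Nearest prior art found: Serre1987 (the level N(ρ̄) and ε-conjecture; no Szpiro-type inequality in
it); arXiv:math/0508174 Poonen–Schaefer–Stoll (explicit twists X_E(7), finiteness/deter  [refs: math/0508174, Serre1987]

Barriers (technique_class: moduli-height, level-lowering, galois-rep, ff-transfer): - technique_class: moduli-height, level-lowering, galois-rep, ff-transfer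
- Literature.Barriers.ABC.BakerMethodBounds: inside its SCOPE only if X1 were attacked by linear
forms in logarithms (ceiling exp-type, `BakerShapeBound`/`EpsShapeBound (2/3)`); the line does not
use LFL — it does not evade the barrier by a new engine either; the bet is the moduli/hyperbolicity
side (effective Mordell for level covers), where no engine exists today (honest: X1 is un-attackable
by known methods; its theorem content is X2, row B and the two rungs).
- Literature.Barriers.ABC.SzpiroEpsilonCannotBeDropped: respected — K is existential and K ≤ 6 is
refuted even for the full conductor (Masser; tree not_polySzpiroRatEff_of_le_six); X1 claims no
exponent.
- Literature.Barriers.ABC.MasonStothersFailsInCharP: not applicable (characteristic 0 target; the FF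
source proof is used only as a dictionary, in char 0 function fields).
- Literature.Barriers.ABC.EpsilonCannotBeDropped / UniformABCDiscriminantSharp: not applicable (no
abc-ε statement is made; target is A-PS).
- Literature.Barriers.ABC.UniformABCImpliesNoSiegelZeros: not applicable — the tribunal token match
(height, moduli) is lexical; the line states no uniform-abc over number fields of varying degree and
draws no Siegel-zero consequence; X1 is over ℚ at one fixed ℓ.
- REDUCTION-CENSUS barrier seeds: B-RUNGE×LEVEL (Runge/Bilu–Parent integral-point methods on X_ρ̄(ℓ)
unavailable: one cusp orbit, level costs degree) — APPLIES to any integral-p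

Novelty grade: known — critic abc-iut-crit-B g1: KNOWN = as filed the deciding crux SerreLevelSzpiro (EXISTS prime l >= 7, EXISTS K C, forall E, framed rho = E[l]: log|Delta_min| <= K log(l N(rho)) + C) is EQUIVALENT to the rung it closes, PolySzpiroRat: A-PS(K) => X1(l) for every prime l > K by the route's own sandwich ( (refuter refuter-abc-iut-crit-B-g1-0, 2026-08-28T03:48:42Z; prior: Summit.ABC.PolySzpiroRat, Literature.NumberTheory.GaloisRepresentations.ModPGaloisRep.serreLevel, doi:10.1215/S0012-7094-87-05413-8, Kraus 1990 Dissertationes Math. 364 (conducteur des points de l-torsion))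

sub-problem: ABC · status: draft · opened planner-abc-idea-5-g0-0 2026-08-28T03:05:50Z · rev 0 · ledger route-ABC-LevelLoweredSzpiro
GENERATED by the gate from the ledger (D-0016/17). Provers cite these decls: `theorem foo : Summit.ABC.ABC.Theses.LevelLoweredSzpiro.<Decl> := …` in Summits/ABC/ABC/Theorems/<Name>.lean.
-/

namespace Summit.ABC.ABC.Theses.LevelLoweredSzpiro

open scoped BigOperators Topology Manifold Classical MeasureTheory ProbabilityTheory Matrix InnerProductSpace ComplexConjugate ContinuousMap
open Filter Set Function TopologicalSpace MeasureTheory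

attribute [summit_statement] _root_.ABC
attribute [summit_statement] _root_.Summit.ABC.PolySzpiroRat

open Literature.Abc

/-- item stmt-ABC-25130 · crux · rank 2 · open · by planner
why it might fail: It bounds ℓ-divisible towers n_p = ℓm at primes p ABSENT from N(ρ̄) by the other primes only; true under Szpiro(6+ε<ℓ) but no engine: effective Mordell for X(ℓ)-points over ℚ(E[ℓ]) is open (Faltings ineffective; Chabauty needs r<g); K<6 is refuted (Masser).
sources: Serre1987, SilvermanATAEC1994, arXiv:math/0508174, Faltings1983, BombieriGubler2006
[crux] LEVEL-LOWERED SZPIRO: there is a prime ℓ ≥ 7 and constants K, C such that for every elliptic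
curve E/ℚ (any model W) and every framed mod-ℓ representation ρ realising E[ℓ], log|Δ_min(E)| ≤
K·log(ℓ·N(ρ)) + C, N(ρ) = Serre level (prime-to-ℓ Artin conductor) of ρ. [difficulty: open-problem] -/
@[route_item "route-ABC-LevelLoweredSzpiro", crux]
def SerreLevelSzpiro : Prop :=
  ∃ ℓ : ℕ, ∃ hℓ : ℓ.Prime, 7 ≤ ℓ ∧ (haveI : Fact ℓ.Prime := ⟨hℓ⟩; ∃ K C : ℝ, ∀ (W : WeierstrassCurve ℚ) [W.IsElliptic] (ρ : Literature.NumberTheory.GaloisRepresentations.ModPGaloisRep ℚ (ZMod ℓ) 2), W.IsTorsionGaloisRep ℓ ρ → Real.log (W.minimalDiscriminantNorm ℤ : ℝ) ≤ K * Real.log ((ℓ : ℝ) * (Literature.NumberTheory.GaloisRepresentations.ModPGaloisRep.serreLevel ℓ ρ : ℝ)) + C)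

/-- item stmt-ABC-25131 · crux · rank 3 · open · by planner
why it might fail: N(ρ̄)∣N(E) for ALL E incl. additive reduction at 2, 3 needs the exponentwise Ogg–Saito fact `artinConductorExponent_tate_eq_conductorExponent_of_isElliptic` (named, undischarged in tree, size L; semistable case proved); serreLevel junk value (=1) is harmless here.
sources: Serre1987, SilvermanATAEC1994, DarmonDiamondTaylor1995
[crux] DICTIONARY PAYOFF: level-lowered Szpiro at one prime ℓ ≥ 7 implies polynomial Szpiro over ℚ
(A-PS): for every E/ℚ a framed mod-ℓ representation ρ with E[ℓ] ≅ ρ exists (tree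
`exists_isTorsionGaloisRep`) and its Serre level divides N(E) (Carayol–Serre (1.2)–(4.1); tree
`serreLevel_baseChange_dvd_conductorNorm_of_artinConductorExponent` modulo the exponentwise
Ogg–Saito identification), so log(ℓ·N(ρ)) ≤ log ℓ + log N(E). [deps: SerreLevelSzpiro] [difficulty:
M] -/
@[route_item "route-ABC-LevelLoweredSzpiro", crux]
def SerreLevelPayoff : Prop :=
  SerreLevelSzpiro → Summit.ABC.PolySzpiroRat

/-- item stmt-ABC-25132 · assembly · rank 1 · open · by planner
sources: Serre1987
[assembly] SerreLevelSzpiro → SerreLevelPayoff → A-PS (polynomial Szpiro over ℚ). -/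
@[route_item "route-ABC-LevelLoweredSzpiro"]
def Assembly : Prop :=
  SerreLevelSzpiro → SerreLevelPayoff → Summit.ABC.PolySzpiroRat

/-! D-0027 §2.1 — DECIDING THEOREM (planner-authored via `route open/edit --closes-file`; by planner-abc-idea-5-g0-0 2026-08-28T03:05:50Z):
its hypotheses are this route's items and its conclusion the registered leaf `Summit.ABC.PolySzpiroRat` (rung ABC-A-PS, D-0061) (glue_lint), and it elaborates with this file. -/

@[closes "route-ABC-LevelLoweredSzpiro"] theorem closes (h₁ : SerreLevelSzpiro) (h₂ : SerreLevelPayoff) : Summit.ABC.PolySzpiroRat :=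
  h₂ h₁

end Summit.ABC.ABC.Theses.LevelLoweredSzpiro
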